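import Literature.MathematicalPhysics.QuantumFieldTheory.Balaban1983to89.B10Eq44Concrete

/-!
# `Balaban1983to89.B10Eq44SpecialUnitary` — T. Bałaban, *Ultraviolet stability of three-dimensional lattice pure gauge
# field theories*, Commun. Math. Phys. **102** (1985) 255–275 [Balaban1985UV3]: the loop-variable factor and the bounds
# (44), (45), (46) p. 267 for the concrete `j`-fold block average of [4] with values in a gauge group closed under the
# average at radius `t` — in particular `G = SU(N)`, the semi-simple case of Theorem 1 p. 257 (theorems only)

statement-level skeleton of published theorems with citation tags; proofs where landed; nothing here is a claim
about the Yang–Mills mass gap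

PDF held: `paper:balaban1985-cmp102-uv-stability-3d` (journal page = PDF page + 254); pp. 266–267 (PDF 12–13), p. 267
read from the render `pub-balaban/b2b-balaban-ref1/pages/1985-cmp102-uv-stability-3d/…-p013-x2.png`; Theorem 1 p. 257
(PDF 3): *"… pure Yang–Mills theory with a semi-simple compact group Lie `G`"*.  "[4]" = [Balaban1985Averaging].

WHAT IS REPRODUCED (mega-formalization `lit-balaban`, HOME `run/shared/lean/pub/lit-balaban/`, Phase-2 proof seat
`p29` gen 5, unit `lit-balaban-p29`; companion of `B10Eq44AvgRegularity` / `B10Eq44Concrete` for SKELETON rows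
`B10.Eq44`, `B10.Eq45`, `B10.Eq46` of reader r07's `ROWS-B10.md`).  `B10Eq44Concrete` derived (44)/(45)/(46) for the
concrete average with values in an `AvgClosed` gauge group (closure of the average (42) at radius `¼`: `U(N)`); a proper
Lie subgroup such as `SU(N)` is closed only at a radius `t` shrinking with `N` (`B7Prop2SpecialUnitary.AvgClosedAt`,
`avgClosedAt_specialUnitary`).  THIS FILE repeats the derivation for `AvgClosedAt t` groups, with the one extra
smallness `32(d+1)(d+4)L²α₀ ≤ t`, `α₀ = 2L²B₃ε` (§1: `reg44_avg_plaq_at`, `loop44_le_at`, `bound44_concrete_at`,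
`bound45_concrete_at`, `bound46_concrete_at` — same statements and proofs as the `AvgClosed` versions with the tree's
radius-`t` ingredients `avgIter_mem_at`, `reg44_avg_at`), and instantiates `G = SU(N) ⊂ M_N(ℂ)` with the operator norm
(19) of [4] (§2: `bound44_specialUnitary`, `bound45_specialUnitary`, `bound46_specialUnitary`; the `G`-dependent
smallness reads `N·32(d+1)(d+4)L²·2L²B₃ε < π`, as in r07's `B10Eq71Concrete.smallFactor_specialUnitary`).  THE PRINTED
TEXT and the MODEL NOTES (M1)–(M7) are those of `B10Eq44AvgRegularity` / `B10Eq44Concrete` ((43) `Shape43` is the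
printed hypothesis on the multilinear coefficients `𝒫_j(Y_j)`; `U_k` any configuration with the p. 267 regularity;
explicit smallness; `ℓ¹` distances; terms indexed by admissible `Y_j`; `d = 3`).  No `sorry`, no definitions, no new
named facts; axioms `propext`, `Classical.choice`, `Quot.sound`.
-/

noncomputable section

open scoped BigOperators
open NormedSpace Finset

namespace Literature.MathematicalPhysics.QuantumFieldTheory.Balaban1983to89.B10Eq44SpecialUnitary

open B7Prop1Explicit B7Prop2Explicit B7Prop2SpecialUnitary B10Eq44AvgRegularity B10Eq44Concrete
open B10Eq27AxialLog (B27 norm_B27_le)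
open B10SectCExpansion (Shape43 Bound44 Bound45 blockSum45 bound44_of_shape43 bound46_of_bound45)
open B10Eq45LatticeSum (l1dist l1dist_nonneg latticeGeometry3 bound45_latticeGeometry3)

export B7Prop1Explicit (Site) -- the `ℤ^d` sites (the torus `Site` of `Setup.lean` would shadow them)

variable {d : ℕ}

/-- `0 < L^jη = L^j(L^k)⁻¹` for `L ≥ 2`. [folklore] -/
private theorem scale_pos {L : ℕ} (hL : 2 ≤ L) (j k : ℕ) : 0 < (L : ℝ) ^ j * ((L : ℝ) ^ k)⁻¹ := by
  have hLr : (2 : ℝ) ≤ L := by exact_mod_cast hL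
  have hL0 : (0 : ℝ) < L := by linarith
  positivity

/-- `L^jη = (L⁻¹)^{k−j}` for `j ≤ k`. [folklore] -/
private theorem scale_eq_inv_pow {L : ℕ} (hL : 2 ≤ L) {j k : ℕ} (hj : j ≤ k) :
    (L : ℝ) ^ j * ((L : ℝ) ^ k)⁻¹ = (L : ℝ)⁻¹ ^ (k - j) := by
  have hL0 : (L : ℝ) ≠ 0 := by
    have : (2 : ℝ) ≤ L := by exact_mod_cast hL
    positivity
  rw [inv_pow, pow_sub₀ _ hL0 hj, mul_inv, inv_inv, mul_comm]

/-! ## §1 Gauge groups closed under the average at radius `t` -/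

section RadiusT

variable {𝔸 : Type} [NormedRing 𝔸] [NormOneClass 𝔸] [NormedAlgebra ℂ 𝔸] [CompleteSpace 𝔸]

/-- **p. 267, the sentence before (44), at a plaquette, radius-`t` gauge group:** `|Ū_k^j(∂p′) − 1| < 4L²B₃ε(L^jη)²`
for every plaquette `p′ = (z; μ, ν)` of `Ω_k^{(j)}`, `j ≤ k` (`ε` = `g_{k−1}p(g_{k−1})`). [cite: Balaban1985UV3, p.267 (sentence before (44))] -/
theorem reg44_avg_plaq_at (L : ℕ) (hL : 2 ≤ L) {G : Subgroup 𝔸ˣ} {t : ℝ} (hG : AvgClosedAt d t L G) (k : ℕ)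
    (U : Site d → Fin d → 𝔸ˣ) (hU : ∀ x κ, U x κ ∈ G) {B₃ ε : ℝ} (hpos : 0 < (L : ℝ) ^ 2 * B₃ * ε)
    (hα3 : C0 d * (2 * (L : ℝ) ^ 2 * B₃ * ε) ≤ 1 / 3) (hα2 : 2 * (2 * (L : ℝ) ^ 2 * B₃ * ε) ≤ c2' d L)
    (hαt : 32 * ((d : ℝ) + 1) * (d + 4) * (L : ℝ) ^ 2 * (2 * (L : ℝ) ^ 2 * B₃ * ε) ≤ t)
    (hreg : pdev U < 2 * (L : ℝ) ^ 2 * B₃ * ε * (((L : ℝ) ^ k)⁻¹) ^ 2) {j : ℕ} (hj : j ≤ k) (z : Site d)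
    (μ ν : Fin d) :
    ‖((hol (avgIter L U j) z (plaqWord μ ν) : 𝔸ˣ) : 𝔸) - 1‖
      < 4 * (L : ℝ) ^ 2 * B₃ * ε * ((L : ℝ) ^ j * ((L : ℝ) ^ k)⁻¹) ^ 2 := by
  have hjU : ∀ x κ, avgIter L U j x κ ∈ U1 𝔸 := fun x κ =>
    hG.le_U1 (avgIter_mem_at L hL hG k U hU (by linarith) hα3 hα2 hαt hreg j hj x κ)
  exact (le_pdev hjU z μ ν).trans_lt (reg44_avg_at L hL hG k U hU hpos hα3 hα2 hαt hreg j hj)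

/-- **The factor of (44), radius-`t` gauge group:** `|B_k(c)| ≤ |c₋ − y|₁ · 8L²B₃ε(L^jη)²` for the loop variables
`B_k(c) = (1/i) log Ū_k^j(Γ_{y,c₋} ∪ c ∪ Γ_{c₊,y})` of (43) at the concrete `Ū_k^j`, on every bond with
`|c₋ − y|₁·4L²B₃ε(L^jη)² ≤ ½` (ladder (28) `B10Eq27AxialLog.norm_B27_le`). [cite: Balaban1985UV3, (44) p.267] -/
theorem loop44_le_at (L : ℕ) (hL : 2 ≤ L) {G : Subgroup 𝔸ˣ} {t : ℝ} (hG : AvgClosedAt d t L G) (k : ℕ)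
    (U : Site d → Fin d → 𝔸ˣ) (hU : ∀ x κ, U x κ ∈ G) {B₃ ε : ℝ} (hpos : 0 < (L : ℝ) ^ 2 * B₃ * ε)
    (hα3 : C0 d * (2 * (L : ℝ) ^ 2 * B₃ * ε) ≤ 1 / 3) (hα2 : 2 * (2 * (L : ℝ) ^ 2 * B₃ * ε) ≤ c2' d L)
    (hαt : 32 * ((d : ℝ) + 1) * (d + 4) * (L : ℝ) ^ 2 * (2 * (L : ℝ) ^ 2 * B₃ * ε) ≤ t)
    (hreg : pdev U < 2 * (L : ℝ) ^ 2 * B₃ * ε * (((L : ℝ) ^ k)⁻¹) ^ 2) {j : ℕ} (hj : j ≤ k) (y x : Site d)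
    (μ : Fin d)
    (hsmall : (l1 (x - y) : ℝ) * (4 * (L : ℝ) ^ 2 * B₃ * ε * ((L : ℝ) ^ j * ((L : ℝ) ^ k)⁻¹) ^ 2) ≤ 1 / 2) :
    ‖B27 (avgIter L U j) y x μ‖
      ≤ (l1 (x - y) : ℝ) * (8 * (L : ℝ) ^ 2 * B₃ * ε * ((L : ℝ) ^ j * ((L : ℝ) ^ k)⁻¹) ^ 2) := by
  have hjU : ∀ x κ, avgIter L U j x κ ∈ U1 𝔸 := fun x κ =>
    hG.le_U1 (avgIter_mem_at L hL hG k U hU (by linarith) hα3 hα2 hαt hreg j hj x κ)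
  have h44 : ∀ (x : Site d) (κ μ : Fin d), κ ≠ μ →
      ‖((hol (avgIter L U j) x (plaqWord κ μ) : 𝔸ˣ) : 𝔸) - 1‖
        ≤ 4 * (L : ℝ) ^ 2 * B₃ * ε * ((L : ℝ) ^ j * ((L : ℝ) ^ k)⁻¹) ^ 2 :=
    fun x κ μ _ => (reg44_avg_plaq_at L hL hG k U hU hpos hα3 hα2 hαt hreg hj x κ μ).le
  have ht0 := scale_pos hL j k
  have h4 : (0 : ℝ) ≤ 4 * (L : ℝ) ^ 2 * B₃ * ε * ((L : ℝ) ^ j * ((L : ℝ) ^ k)⁻¹) ^ 2 := by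
    have h := mul_pos hpos (pow_pos ht0 2)
    linarith
  have h := norm_B27_le (avgIter L U j) hjU y h44 h4 x μ hsmall
  convert h using 1
  ring

/-- **(44) p. 267 for the concrete average with values in a radius-`t` gauge group** — as
`B10Eq44Concrete.bound44_concrete` (`G` `AvgClosed`), with the extra smallness `32(d+1)(d+4)L²·2L²B₃gp ≤ t`, `d = 3`.
[cite: Balaban1985UV3, (44) p.267] -/
theorem bound44_concrete_at (L : ℕ) (hL : 2 ≤ L) {G : Subgroup 𝔸ˣ} {t : ℝ} (hG : AvgClosedAt 3 t L G) (k : ℕ)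
    (U : Site 3 → Fin 3 → 𝔸ˣ) (hU : ∀ x κ, U x κ ∈ G) {B₃ g pg : ℝ} (hpos : 0 < (L : ℝ) ^ 2 * B₃ * (g * pg))
    (hα3 : C0 3 * (2 * (L : ℝ) ^ 2 * B₃ * (g * pg)) ≤ 1 / 3)
    (hα2 : 2 * (2 * (L : ℝ) ^ 2 * B₃ * (g * pg)) ≤ c2' 3 L)
    (hαt : 32 * ((3 : ℝ) + 1) * (3 + 4) * (L : ℝ) ^ 2 * (2 * (L : ℝ) ^ 2 * B₃ * (g * pg)) ≤ t)
    (hreg : pdev U < 2 * (L : ℝ) ^ 2 * B₃ * (g * pg) * (((L : ℝ) ^ k)⁻¹) ^ 2) {j : ℕ} (hj : j ≤ k)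
    (tl : Set (Site 3 × Fin 3) → Set (Site 3) → ℝ) (P : Coef 𝔸) {κ₁ M₁ C : ℝ} (hC : 0 ≤ C)
    (h43 : Shape43 (latticeGeometry3 ((L : ℝ) ^ j * ((L : ℝ) ^ k)⁻¹) tl) (coefSize P) κ₁ M₁
      ((L : ℝ) ^ j * ((L : ℝ) ^ k)⁻¹) C)
    {D : ℕ} (hD : (D : ℝ) * (4 * (L : ℝ) ^ 2 * B₃ * (g * pg) * ((L : ℝ) ^ j * ((L : ℝ) ^ k)⁻¹) ^ 2) ≤ 1 / 2) :
    Bound44 (latticeGeometry3 ((L : ℝ) ^ j * ((L : ℝ) ^ k)⁻¹) tl) (evalSize P D (avgIter L U j)) κ₁ M₁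
      ((L : ℝ) ^ j * ((L : ℝ) ^ k)⁻¹) (L : ℝ) B₃ g pg C := by
  classical
  have hℓ0 := scale_pos hL j k
  set ℓ : ℝ := (L : ℝ) ^ j * ((L : ℝ) ^ k)⁻¹ with hℓ
  have hfac : 0 ≤ 8 * (L : ℝ) ^ 2 * B₃ * g * pg * ℓ ^ 2 := by
    have h := mul_pos hpos (pow_pos hℓ0 2)
    linarith
  have hfac4 : 0 ≤ 4 * (L : ℝ) ^ 2 * B₃ * (g * pg) * ℓ ^ 2 := by
    have h := mul_pos hpos (pow_pos hℓ0 2)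
    linarith
  let loop : Site 3 → Site 3 × Fin 3 → ℝ := fun y b =>
    if l1 (b.1 - y) ≤ D then ‖B27 (avgIter L U j) y b.1 b.2‖ else 0
  have hloop_nonneg : ∀ y b, 0 ≤ loop y b := fun y b => by
    simp only [loop]; split_ifs
    · exact norm_nonneg _
    · exact le_rfl
  have hloop_in : ∀ (y : Site 3) (b : Site 3 × Fin 3), l1 (b.1 - y) ≤ D →
      ‖B27 (avgIter L U j) y b.1 b.2‖ ≤ (l1 (b.1 - y) : ℝ) * (8 * (L : ℝ) ^ 2 * B₃ * (g * pg) * ℓ ^ 2) := by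
    intro y b hb
    refine loop44_le_at L hL hG k U hU hpos hα3 hα2 hαt hreg hj y b.1 b.2 ?_
    have hbD : (l1 (b.1 - y) : ℝ) ≤ D := by exact_mod_cast hb
    exact (mul_le_mul_of_nonneg_right hbD hfac4).trans hD
  refine bound44_of_shape43 (latticeGeometry3 ℓ tl) (coefSize P) (evalSize P D (avgIter L U j)) loop hC h43
    hloop_nonneg (fun (y : Site 3) (b : Site 3 × Fin 3) => ?_)
    (fun (y : Site 3) (n : ℕ) (c : Fin n → Site 3 × Fin 3) => ?_)
  · have hdist : ℓ⁻¹ * (ℓ * l1dist b.1 y) = (l1 (b.1 - y) : ℝ) := by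
      rw [← mul_assoc, inv_mul_cancel₀ hℓ0.ne', one_mul, cast_l1_eq_l1dist]
    show loop y b ≤ (ℓ⁻¹ * (ℓ * l1dist b.1 y)) * (8 * (L : ℝ) ^ 2 * B₃ * g * pg * ℓ ^ 2)
    rw [hdist]
    simp only [loop]
    split_ifs with hb
    · have h := hloop_in y b hb
      convert h using 1; ring
    · exact mul_nonneg (Nat.cast_nonneg _) hfac
  · simp only [evalSize, coefSize]
    split_ifs with hadm
    · rw [abs_of_nonneg (norm_nonneg _), abs_of_nonneg (norm_nonneg _)]
      refine (ContinuousMultilinearMap.le_opNorm _ _).trans (le_of_eq ?_)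
      congr 1
      refine Finset.prod_congr rfl fun i _ => ?_
      simp only [loop, if_pos (hadm i)]
    · rw [abs_zero]
      exact mul_nonneg (abs_nonneg _) (Finset.prod_nonneg fun i _ => hloop_nonneg y (c i))

/-- **(45) p. 267 for the concrete average with values in a radius-`t` gauge group** — as
`B10Eq44Concrete.bound45_concrete`. [cite: Balaban1985UV3, (45) p.267] -/
theorem bound45_concrete_at (L : ℕ) (hL : 2 ≤ L) {G : Subgroup 𝔸ˣ} {t : ℝ} (hG : AvgClosedAt 3 t L G) (k : ℕ)
    (U : Site 3 → Fin 3 → 𝔸ˣ) (hU : ∀ x κ, U x κ ∈ G) {B₃ g pg : ℝ} (hB : 0 ≤ B₃) (hg : 0 ≤ g) (hpg : 0 ≤ pg)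
    (hpos : 0 < (L : ℝ) ^ 2 * B₃ * (g * pg)) (hα3 : C0 3 * (2 * (L : ℝ) ^ 2 * B₃ * (g * pg)) ≤ 1 / 3)
    (hα2 : 2 * (2 * (L : ℝ) ^ 2 * B₃ * (g * pg)) ≤ c2' 3 L)
    (hαt : 32 * ((3 : ℝ) + 1) * (3 + 4) * (L : ℝ) ^ 2 * (2 * (L : ℝ) ^ 2 * B₃ * (g * pg)) ≤ t)
    (hreg : pdev U < 2 * (L : ℝ) ^ 2 * B₃ * (g * pg) * (((L : ℝ) ^ k)⁻¹) ^ 2) {j : ℕ} (hj : j ≤ k)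
    (tl : Set (Site 3 × Fin 3) → Set (Site 3) → ℝ) (P : Coef 𝔸) {κ₁ M₁ C : ℝ} (hκ : 0 < κ₁) (hM : 0 < M₁)
    (hC : 0 ≤ C)
    (h43 : Shape43 (latticeGeometry3 ((L : ℝ) ^ j * ((L : ℝ) ^ k)⁻¹) tl) (coefSize P) κ₁ M₁
      ((L : ℝ) ^ j * ((L : ℝ) ^ k)⁻¹) C)
    {D : ℕ} (hD : (D : ℝ) * (4 * (L : ℝ) ^ 2 * B₃ * (g * pg) * ((L : ℝ) ^ j * ((L : ℝ) ^ k)⁻¹) ^ 2) ≤ 1 / 2)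
    (adm : Site 3 → Finset (Site 3 × Fin 3)) (N : ℕ)
    (hsmall : 8 * (L : ℝ) ^ 2 * B₃ * (3 * ((2 * M₁ / κ₁) * (1 + 4 * M₁ / κ₁) ^ 3)) * g * pg *
      ((L : ℝ) ^ j * ((L : ℝ) ^ k)⁻¹) ^ 2 ≤ 1 / 2) :
    Bound45 (latticeGeometry3 ((L : ℝ) ^ j * ((L : ℝ) ^ k)⁻¹) tl)
      (blockSum45 (latticeGeometry3 ((L : ℝ) ^ j * ((L : ℝ) ^ k)⁻¹) tl) (evalSize P D (avgIter L U j)) adm N)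
      (8 * (L : ℝ) ^ 2 * B₃ * (3 * ((2 * M₁ / κ₁) * (1 + 4 * M₁ / κ₁) ^ 3))) g pg
      ((L : ℝ) ^ j * ((L : ℝ) ^ k)⁻¹) (2 * C) :=
  bound45_latticeGeometry3 hκ hM (scale_pos hL j k) hC hB hg hpg tl (evalSize P D (avgIter L U j)) adm N
    (bound44_concrete_at L hL hG k U hU hpos hα3 hα2 hαt hreg hj tl P hC h43 hD)
    (evalSize_floor P D (avgIter L U j) h43) hsmall

/-- **(46) p. 267 for the concrete average with values in a radius-`t` gauge group** — as
`B10Eq44Concrete.bound46_concrete` (v1.1): r07's `bound46_of_bound45` fed with `bound45_concrete_at` at every scale.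
[cite: Balaban1985UV3, (46) p.267] -/
theorem bound46_concrete_at (L : ℕ) (hL : 2 ≤ L) {G : Subgroup 𝔸ˣ} {t : ℝ} (hG : AvgClosedAt 3 t L G) (k : ℕ)
    (U : Site 3 → Fin 3 → 𝔸ˣ) (hU : ∀ x κ, U x κ ∈ G) {B₃ g pg : ℝ} (hB : 0 ≤ B₃) (hg : 0 ≤ g) (hpg : 0 ≤ pg)
    (hpos : 0 < (L : ℝ) ^ 2 * B₃ * (g * pg)) (hα3 : C0 3 * (2 * (L : ℝ) ^ 2 * B₃ * (g * pg)) ≤ 1 / 3)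
    (hα2 : 2 * (2 * (L : ℝ) ^ 2 * B₃ * (g * pg)) ≤ c2' 3 L)
    (hαt : 32 * ((3 : ℝ) + 1) * (3 + 4) * (L : ℝ) ^ 2 * (2 * (L : ℝ) ^ 2 * B₃ * (g * pg)) ≤ t)
    (hreg : pdev U < 2 * (L : ℝ) ^ 2 * B₃ * (g * pg) * (((L : ℝ) ^ k)⁻¹) ^ 2)
    (tl : ℕ → Set (Site 3 × Fin 3) → Set (Site 3) → ℝ) (P : ℕ → Coef 𝔸) {κ₁ M₁ C : ℝ} (hκ : 0 < κ₁)
    (hM : 0 < M₁) (hC : 0 ≤ C)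
    (h43 : ∀ j ∈ Finset.Icc 1 k, Shape43 (latticeGeometry3 ((L : ℝ) ^ j * ((L : ℝ) ^ k)⁻¹) (tl j))
      (coefSize (P j)) κ₁ M₁ ((L : ℝ) ^ j * ((L : ℝ) ^ k)⁻¹) C)
    (D : ℕ → ℕ) (hD : ∀ j ∈ Finset.Icc 1 k,
      (D j : ℝ) * (4 * (L : ℝ) ^ 2 * B₃ * (g * pg) * ((L : ℝ) ^ j * ((L : ℝ) ^ k)⁻¹) ^ 2) ≤ 1 / 2)
    (adm : ℕ → Site 3 → Finset (Site 3 × Fin 3)) (N : ℕ → ℕ)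
    (hsmall : ∀ j ∈ Finset.Icc 1 k, 8 * (L : ℝ) ^ 2 * B₃ * (3 * ((2 * M₁ / κ₁) * (1 + 4 * M₁ / κ₁) ^ 3)) * g * pg *
      ((L : ℝ) ^ j * ((L : ℝ) ^ k)⁻¹) ^ 2 ≤ 1 / 2)
    (blocks : ℕ → Finset (Site 3)) {Λvol : ℝ} (hΛ : 0 ≤ Λvol)
    (hcard : ∀ j ∈ Finset.Icc 1 k,
      ((blocks j).card : ℝ) ≤ (M₁ * ((L : ℝ) ^ j * ((L : ℝ) ^ k)⁻¹))⁻¹ ^ 3 * Λvol) :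
    ∑ j ∈ Finset.Icc 1 k, ∑ y ∈ blocks j,
        blockSum45 (latticeGeometry3 ((L : ℝ) ^ j * ((L : ℝ) ^ k)⁻¹) (tl j))
          (evalSize (P j) (D j) (avgIter L U j)) (adm j) (N j) y ≤
      2 * C * (8 * (L : ℝ) ^ 2 * B₃ * (3 * ((2 * M₁ / κ₁) * (1 + 4 * M₁ / κ₁) ^ 3))) ^ 2 * M₁⁻¹ ^ 3 *
        ((L : ℝ) / ((L : ℝ) - 1)) * (g * pg) ^ 2 * Λvol := by
  have hLr : (1 : ℝ) < L := by exact_mod_cast lt_of_lt_of_le (by norm_num) hL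
  exact bound46_of_bound45 (latticeGeometry3 1 (tl 0)) k blocks
    (fun j y => blockSum45 (latticeGeometry3 ((L : ℝ) ^ j * ((L : ℝ) ^ k)⁻¹) (tl j))
      (evalSize (P j) (D j) (avgIter L U j)) (adm j) (N j) y)
    (fun j => (L : ℝ) ^ j * ((L : ℝ) ^ k)⁻¹) hLr hM (by positivity : (0 : ℝ) ≤ 2 * C) hΛ
    (fun j hj => scale_eq_inv_pow hL (Finset.mem_Icc.mp hj).2)
    (fun j hj => bound45_concrete_at L hL hG k U hU hB hg hpg hpos hα3 hα2 hαt hreg (Finset.mem_Icc.mp hj).2 (tl j)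
      (P j) hκ hM hC (h43 j hj) (hD j hj) (adm j) (N j) (hsmall j hj))
    hcard

end RadiusT

/-! ## §2 `G = SU(N) ⊂ M_N(ℂ)`: the semi-simple case of Theorem 1 -/

section SpecialUnitary

open scoped Matrix.Norms.L2Operator

variable {n : Type} [Fintype n] [DecidableEq n] [Nonempty n]

/-- The closure-radius clause for `SU(N)`: `2α₀ ≤ c₂′(3, L)` gives `32·4·7·L²α₀ ≤ ¼`. [folklore] -/
private theorem radius_quarter3 {L : ℕ} (hL : 2 ≤ L) {α₀ : ℝ} (hα2 : 2 * α₀ ≤ c2' 3 L) :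
    32 * ((3 : ℝ) + 1) * (3 + 4) * (L : ℝ) ^ 2 * α₀ ≤ 1 / 4 := by
  have hL1 : (1 : ℝ) ≤ L := by exact_mod_cast le_trans (by norm_num) hL
  have hpos : (0 : ℝ) < 512 * ((3 : ℝ) + 1) * (3 + 4) * (L : ℝ) ^ 2 := by positivity
  have h1 : 2 * α₀ ≤ 1 / (512 * ((3 : ℝ) + 1) * (3 + 4) * (L : ℝ) ^ 2) := hα2
  rw [le_div_iff₀ hpos] at h1
  nlinarith

/-- **(44) p. 267 for `G = SU(N) ⊂ M_N(ℂ)`, operator norm (19) of [4]** (Theorem 1 p. 257: *"a semi-simple compact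
group"*), with the one `G`-dependent smallness `N·32(d+1)(d+4)L²·2L²B₃gp < π` keeping the average (42) in `SU(N)`
(`avgClosedAt_specialUnitary`). [cite: Balaban1985UV3, (44) p.267, Thm 1 p.257] -/
theorem bound44_specialUnitary (L : ℕ) (hL : 2 ≤ L) (k : ℕ) (U : Site 3 → Fin 3 → (Matrix n n ℂ)ˣ)
    (hU : ∀ x κ, U x κ ∈ specialUnitaryUnits n) {B₃ g pg : ℝ} (hpos : 0 < (L : ℝ) ^ 2 * B₃ * (g * pg))
    (hα3 : C0 3 * (2 * (L : ℝ) ^ 2 * B₃ * (g * pg)) ≤ 1 / 3)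
    (hα2 : 2 * (2 * (L : ℝ) ^ 2 * B₃ * (g * pg)) ≤ c2' 3 L)
    (hαN : Fintype.card n * (32 * ((3 : ℝ) + 1) * (3 + 4) * (L : ℝ) ^ 2 * (2 * (L : ℝ) ^ 2 * B₃ * (g * pg)))
      < Real.pi)
    (hreg : pdev U < 2 * (L : ℝ) ^ 2 * B₃ * (g * pg) * (((L : ℝ) ^ k)⁻¹) ^ 2) {j : ℕ} (hj : j ≤ k)
    (tl : Set (Site 3 × Fin 3) → Set (Site 3) → ℝ) (P : Coef (Matrix n n ℂ)) {κ₁ M₁ C : ℝ} (hC : 0 ≤ C)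
    (h43 : Shape43 (latticeGeometry3 ((L : ℝ) ^ j * ((L : ℝ) ^ k)⁻¹) tl) (coefSize P) κ₁ M₁
      ((L : ℝ) ^ j * ((L : ℝ) ^ k)⁻¹) C)
    {D : ℕ} (hD : (D : ℝ) * (4 * (L : ℝ) ^ 2 * B₃ * (g * pg) * ((L : ℝ) ^ j * ((L : ℝ) ^ k)⁻¹) ^ 2) ≤ 1 / 2) :
    Bound44 (latticeGeometry3 ((L : ℝ) ^ j * ((L : ℝ) ^ k)⁻¹) tl) (evalSize P D (avgIter L U j)) κ₁ M₁
      ((L : ℝ) ^ j * ((L : ℝ) ^ k)⁻¹) (L : ℝ) B₃ g pg C := by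
  letI : CStarAlgebra (Matrix n n ℂ) := {}
  exact bound44_concrete_at L hL (avgClosedAt_specialUnitary 3 L (radius_quarter3 hL hα2) hαN) k U hU hpos hα3 hα2
    le_rfl hreg hj tl P hC h43 hD

/-- **(45) p. 267 for `G = SU(N) ⊂ M_N(ℂ)`, operator norm.** [cite: Balaban1985UV3, (45) p.267, Thm 1 p.257] -/
theorem bound45_specialUnitary (L : ℕ) (hL : 2 ≤ L) (k : ℕ) (U : Site 3 → Fin 3 → (Matrix n n ℂ)ˣ)
    (hU : ∀ x κ, U x κ ∈ specialUnitaryUnits n) {B₃ g pg : ℝ} (hB : 0 ≤ B₃) (hg : 0 ≤ g) (hpg : 0 ≤ pg)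
    (hpos : 0 < (L : ℝ) ^ 2 * B₃ * (g * pg)) (hα3 : C0 3 * (2 * (L : ℝ) ^ 2 * B₃ * (g * pg)) ≤ 1 / 3)
    (hα2 : 2 * (2 * (L : ℝ) ^ 2 * B₃ * (g * pg)) ≤ c2' 3 L)
    (hαN : Fintype.card n * (32 * ((3 : ℝ) + 1) * (3 + 4) * (L : ℝ) ^ 2 * (2 * (L : ℝ) ^ 2 * B₃ * (g * pg)))
      < Real.pi)
    (hreg : pdev U < 2 * (L : ℝ) ^ 2 * B₃ * (g * pg) * (((L : ℝ) ^ k)⁻¹) ^ 2) {j : ℕ} (hj : j ≤ k)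
    (tl : Set (Site 3 × Fin 3) → Set (Site 3) → ℝ) (P : Coef (Matrix n n ℂ)) {κ₁ M₁ C : ℝ} (hκ : 0 < κ₁)
    (hM : 0 < M₁) (hC : 0 ≤ C)
    (h43 : Shape43 (latticeGeometry3 ((L : ℝ) ^ j * ((L : ℝ) ^ k)⁻¹) tl) (coefSize P) κ₁ M₁
      ((L : ℝ) ^ j * ((L : ℝ) ^ k)⁻¹) C)
    {D : ℕ} (hD : (D : ℝ) * (4 * (L : ℝ) ^ 2 * B₃ * (g * pg) * ((L : ℝ) ^ j * ((L : ℝ) ^ k)⁻¹) ^ 2) ≤ 1 / 2)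
    (adm : Site 3 → Finset (Site 3 × Fin 3)) (N : ℕ)
    (hsmall : 8 * (L : ℝ) ^ 2 * B₃ * (3 * ((2 * M₁ / κ₁) * (1 + 4 * M₁ / κ₁) ^ 3)) * g * pg *
      ((L : ℝ) ^ j * ((L : ℝ) ^ k)⁻¹) ^ 2 ≤ 1 / 2) :
    Bound45 (latticeGeometry3 ((L : ℝ) ^ j * ((L : ℝ) ^ k)⁻¹) tl)
      (blockSum45 (latticeGeometry3 ((L : ℝ) ^ j * ((L : ℝ) ^ k)⁻¹) tl) (evalSize P D (avgIter L U j)) adm N)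
      (8 * (L : ℝ) ^ 2 * B₃ * (3 * ((2 * M₁ / κ₁) * (1 + 4 * M₁ / κ₁) ^ 3))) g pg
      ((L : ℝ) ^ j * ((L : ℝ) ^ k)⁻¹) (2 * C) := by
  letI : CStarAlgebra (Matrix n n ℂ) := {}
  exact bound45_concrete_at L hL (avgClosedAt_specialUnitary 3 L (radius_quarter3 hL hα2) hαN) k U hU hB hg hpg
    hpos hα3 hα2 le_rfl hreg hj tl P hκ hM hC h43 hD adm N hsmall

/-- **(46) p. 267 for `G = SU(N) ⊂ M_N(ℂ)`, operator norm: the sum of all interaction terms.**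
[cite: Balaban1985UV3, (46) p.267, Thm 1 p.257] -/
theorem bound46_specialUnitary (L : ℕ) (hL : 2 ≤ L) (k : ℕ) (U : Site 3 → Fin 3 → (Matrix n n ℂ)ˣ)
    (hU : ∀ x κ, U x κ ∈ specialUnitaryUnits n) {B₃ g pg : ℝ} (hB : 0 ≤ B₃) (hg : 0 ≤ g) (hpg : 0 ≤ pg)
    (hpos : 0 < (L : ℝ) ^ 2 * B₃ * (g * pg)) (hα3 : C0 3 * (2 * (L : ℝ) ^ 2 * B₃ * (g * pg)) ≤ 1 / 3)
    (hα2 : 2 * (2 * (L : ℝ) ^ 2 * B₃ * (g * pg)) ≤ c2' 3 L)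
    (hαN : Fintype.card n * (32 * ((3 : ℝ) + 1) * (3 + 4) * (L : ℝ) ^ 2 * (2 * (L : ℝ) ^ 2 * B₃ * (g * pg)))
      < Real.pi)
    (hreg : pdev U < 2 * (L : ℝ) ^ 2 * B₃ * (g * pg) * (((L : ℝ) ^ k)⁻¹) ^ 2)
    (tl : ℕ → Set (Site 3 × Fin 3) → Set (Site 3) → ℝ) (P : ℕ → Coef (Matrix n n ℂ)) {κ₁ M₁ C : ℝ}
    (hκ : 0 < κ₁) (hM : 0 < M₁) (hC : 0 ≤ C)
    (h43 : ∀ j ∈ Finset.Icc 1 k, Shape43 (latticeGeometry3 ((L : ℝ) ^ j * ((L : ℝ) ^ k)⁻¹) (tl j))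
      (coefSize (P j)) κ₁ M₁ ((L : ℝ) ^ j * ((L : ℝ) ^ k)⁻¹) C)
    (D : ℕ → ℕ) (hD : ∀ j ∈ Finset.Icc 1 k,
      (D j : ℝ) * (4 * (L : ℝ) ^ 2 * B₃ * (g * pg) * ((L : ℝ) ^ j * ((L : ℝ) ^ k)⁻¹) ^ 2) ≤ 1 / 2)
    (adm : ℕ → Site 3 → Finset (Site 3 × Fin 3)) (N : ℕ → ℕ)
    (hsmall : ∀ j ∈ Finset.Icc 1 k, 8 * (L : ℝ) ^ 2 * B₃ * (3 * ((2 * M₁ / κ₁) * (1 + 4 * M₁ / κ₁) ^ 3)) * g * pg *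
      ((L : ℝ) ^ j * ((L : ℝ) ^ k)⁻¹) ^ 2 ≤ 1 / 2)
    (blocks : ℕ → Finset (Site 3)) {Λvol : ℝ} (hΛ : 0 ≤ Λvol)
    (hcard : ∀ j ∈ Finset.Icc 1 k,
      ((blocks j).card : ℝ) ≤ (M₁ * ((L : ℝ) ^ j * ((L : ℝ) ^ k)⁻¹))⁻¹ ^ 3 * Λvol) :
    ∑ j ∈ Finset.Icc 1 k, ∑ y ∈ blocks j,
        blockSum45 (latticeGeometry3 ((L : ℝ) ^ j * ((L : ℝ) ^ k)⁻¹) (tl j))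
          (evalSize (P j) (D j) (avgIter L U j)) (adm j) (N j) y ≤
      2 * C * (8 * (L : ℝ) ^ 2 * B₃ * (3 * ((2 * M₁ / κ₁) * (1 + 4 * M₁ / κ₁) ^ 3))) ^ 2 * M₁⁻¹ ^ 3 *
        ((L : ℝ) / ((L : ℝ) - 1)) * (g * pg) ^ 2 * Λvol := by
  letI : CStarAlgebra (Matrix n n ℂ) := {}
  exact bound46_concrete_at L hL (avgClosedAt_specialUnitary 3 L (radius_quarter3 hL hα2) hαN) k U hU hB hg hpg
    hpos hα3 hα2 le_rfl hreg tl P hκ hM hC h43 D hD adm N hsmall blocks hΛ hcard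

end SpecialUnitary

end Literature.MathematicalPhysics.QuantumFieldTheory.Balaban1983to89.B10Eq44SpecialUnitary

end
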